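import Literature.Probability.LatticeModels.RandomWalkLoopMeasure
import Mathlib.LinearAlgebra.Matrix.Determinant.Basic
import HarnessLib
import Mathlib.Analysis.Matrix.Spectrum
import Mathlib.Analysis.SpecialFunctions.Log.Deriv
import Mathlib.LinearAlgebra.Matrix.Trace
import Mathlib.Combinatorics.SimpleGraph.AdjMatrix
import Mathlib.Combinatorics.SimpleGraph.Walk.Maps
import Mathlib.Topology.Algebra.InfiniteSum.ENNReal

/-!
# The loop-measure / determinant identity `exp m[ℒ(A; B)] = det(I − Q_{A∖B}) / det(I − Q_A)`
# (Lawler 2018, Prop. 5.2 with Prop. 3.5 and Def. 3)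

Topic `Literature/Probability/LatticeModels`, next to `RandomWalkLoopMeasure.lean` (whose
`rwLoopMass G W = m[ℒ(A; W)]` and `rwLoopTerm` are used, Type II simple-random-walk weight
`q = 1/4` on the edges of a subgraph `G ≤ ℤ²`). ONE named fact (result in print, `def … : Prop`,
D-0014), vendored while grounding route `CriticalPhenomena/SAWDeterminantalDiagonal`, informal
support item stmt-CriticalPhenomena-8350 `DeterminantalIdentities` part (i) ("Lawler/Jacobi:
`exp(m_V(S)) = det((I − P_V)⁻¹|_{S×S}) = det(I − P_{V∖S})/det(I − P_V)` for every `S ⊆ V`, `P_V` the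
simple-random-walk kernel killed off `V`"), and the rider the module docstring of
`RandomWalkLoopMeasure.lean` lists as "NOT here … the determinant formula
`exp (rwLoopMass G W) = det(I − Q_{A∖W}) / det(I − Q_A)` (Lawler 2018 Prop. 3.5 / Lawler–Limic 2010
Lemma 9.3.2)". It is the lattice identity behind the LERW dressing `e^{s·m_D(η)}` of that route and
of routes `SAWLoopAvoidanceChaos` / `SAWChargeContinuation` (`c = −2` bookkeeping).

G. F. Lawler, *Topics in loop measures and the loop-erased walk*, Probab. Surveys 15 (2018) 28–101 =
arXiv:1709.07531 (held text read; arXiv page numbers):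

* §2 p. 5: "we say that `q` is an integrable weight on `A` if the largest positive eigenvalue of
  `|Q|` is strictly less than one"; `G_A(x, y) = Σ_{ω: x → y in A} q(ω)` the Green's function, and
  `Q` the matrix `[q(x, y)]_{x,y ∈ A}`.
* Def. 3 p. 8: "If `B = {x₁,…,xₙ} ⊂ A`, then `F_B(A) = ∏_{j=1}^n G_{A_j}(x_j, x_j)`,
  `A_j = A ∖ {x₁,…,x_{j−1}}`", with the rule `F_{B₁ ∪ B₂}(A) = F_{B₁}(A) F_{B₂}(A ∖ B₁)`, and
  `F(A) = F_A(A)`; hence `F(A) = F_B(A) · F(A ∖ B)`.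
* **Prop. 3.5** p. 9: "`F(A) = det G_A = 1 / det(I − Q)`."
* Def. 8 / Def. 10 p. 17: rooted loop measure `m̃(l) = q(l)/|l|` on loops of positive length;
  the unrooted measure `m`; `ℒ(A; B)` the loops in `A` meeting `B`.
* **Prop. 5.2** p. 17: "Suppose that `q` is an integrable weight on `A`. … If `B ⊂ A`, then
  `F_B(A) = exp{m[ℒ(A; B)]}`. In particular, `exp{m[ℒ(A)]} = F(A) = det G_A = 1/det[I − Q]`."

Combining: `exp m[ℒ(A; B)] = F_B(A) = F(A)/F(A ∖ B) = det(I − Q_{A∖B}) / det(I − Q_A)`, where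
`Q_{A∖B}` is the principal sub-matrix of `Q` on `A ∖ B` (the walk additionally killed on `B`).

## Rendering

* The weight is the tree's: `q(x, y) = 1/4` on the edges of `G : SimpleGraph (Site 2)`,
  `G ≤ zdGraph 2` (Type II simple random walk of `ℤ²` killed when it attempts a non-edge of `G`);
  `A` = a finite vertex set `V` carrying all edges of `G` (so every loop of positive length lies
  in `V`, and `m[ℒ(A; B)] = rwLoopMass G B`, summed with `rwLoopTerm`). `Q_V : Matrix V V ℝ` is
  `(x, y) ↦ 1/4` if `G.Adj x y` else `0`; killing on `B` = restricting to `V ∖ B`.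
* Integrability of THIS `q` on such finite `V` is automatic (each connected component of `G` on `V`
  is a finite subgraph of `ℤ²`, hence has a vertex of `G`-degree `< 4` — the one of maximal first
  coordinate — so `Q` is irreducible-by-blocks, substochastic with a strict row, and its Perron
  root is `< 1`), which is why the fact is stated for all such `(G, V, B)` with the summability of
  the loop series and `det(I − Q_V) ≠ 0` as part of the conclusion (both are consequences of
  integrability printed in §2–§3: `F(A) = 1/det(I − Q)` is finite and positive).
* Division-free form `exp(m) · det(I − Q_V) = det(I − Q_{V∖B})`, equivalent given `det ≠ 0`.
* `B ⊆ V` WLOG (`F_B(A) = F_{B∩A}(A)` by convention, Def. 3; loops only see `B ∩ V`).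

## Tree / Mathlib search

`rwLoopMass`, `rwLoopTerm`, `rwLoopFactor`, `rwGreen` (RandomWalkLoopMeasure.lean; no determinant
formula, flagged there as missing); `dirichletMatrix Λ = 4I − A` restricted to `Λ` for the FULL
lattice (`DirichletGreenFunction.lean`: equals `4(I − Q_Λ)` only when `G` is the induced subgraph,
so it is not used here); `killedGreen` (SAWExcursionAvoidance.lean). Mathlib: `Matrix.det`,
`Matrix.of`, `SimpleGraph.adjMatrix`/`lapMatrix` (need `Fintype V`; we work on a `Finset` of the
infinite type `Site 2`, hence the explicit `Matrix.of`). `lean search 'det.*rwLoop|rwLoop.*det'`: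
0 hits.

## References

* [Lawler2018] G. F. Lawler, Probab. Surveys 15 (2018), arXiv:1709.07531: §2 (p. 5, integrable
  weights), Def. 3 (p. 8), Prop. 3.5 (p. 9), Def. 8, Def. 10, Prop. 5.2 (p. 17).
* [LawlerLimic2010] G. F. Lawler, V. Limic, *Random Walk: A Modern Introduction*, CUP 2010,
  Lemma 9.3.2, Prop. 9.5.1 (the same identity).
* [KozdronLawler2007] M. Kozdron, G. F. Lawler, §6 (LERW weight `4^{-|η|} det`, `λ`-SAW).
-/

noncomputable section

open scoped Classical

namespace Literature.Probability.LatticeModels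

/-- The **killed simple-random-walk kernel** of `G` on the finite vertex set `V`:
`Q_V(x, y) = 1/4` if `x ∼ y` in `G`, else `0` (`x, y ∈ V`) — the matrix `Q = [q(x,y)]_{x,y ∈ A}` of
Lawler 2018 §2 for the Type II weight `q = 1/4` on the edges of `G`; restricting `V` kills the
walk on the removed vertices. [cite: Lawler2018, §2 (the matrix Q of a weight; Type II simple random walk)] -/
def rwKernelMatrix (G : SimpleGraph (Site 2)) (V : Finset (Site 2)) : Matrix V V ℝ :=
  Matrix.of fun x y => if G.Adj (x : Site 2) (y : Site 2) then (1 / 4 : ℝ) else 0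

/-- Entries of `rwKernelMatrix` (definitional). [folklore] -/
theorem rwKernelMatrix_apply (G : SimpleGraph (Site 2)) (V : Finset (Site 2)) (x y : V) :
    rwKernelMatrix G V x y = if G.Adj (x : Site 2) (y : Site 2) then (1 / 4 : ℝ) else 0 := rfl

/-- **Lawler 2018, Prop. 5.2 with Prop. 3.5 (loop measure of the loops meeting `B` as a ratio of
determinants).** *"Suppose that `q` is an integrable weight on `A`. If `B ⊂ A`, then
`F_B(A) = exp{m[ℒ(A;B)]}`. In particular `exp{m[ℒ(A)]} = F(A) = det G_A = 1/det[I − Q]`"*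
(Prop. 5.2, Prop. 3.5), whence, with `F(A) = F_B(A) F(A ∖ B)` (Def. 3),
`exp m[ℒ(A; B)] = det(I − Q_{A∖B}) / det(I − Q_A)`. Rendered for the Type II simple-random-walk
weight `1/4` on the edges of a subgraph `G ≤ ℤ²` all of whose edges lie in the finite set `V`
(= `A`; integrability is then automatic, see the module docstring), `B ⊆ V`, with the tree's loop
mass `rwLoopMass G B = m[ℒ(V; B)]`: the loop series is summable, `det(I − Q_V) ≠ 0`, and
`exp(rwLoopMass G B) · det(I − Q_V) = det(I − Q_{V∖B})`. [cite: Lawler2018, Proposition 5.2 and Proposition 3.5 (with Definition 3)] -/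
def Lawler2018_exp_rwLoopMass_eq_det_ratio : Prop :=
  ∀ (G : SimpleGraph (Site 2)) (V B : Finset (Site 2)),
    G ≤ zdGraph 2 → (∀ x y : Site 2, G.Adj x y → x ∈ V ∧ y ∈ V) → B ⊆ V →
    Summable (rwLoopTerm G (↑B : Set (Site 2))) ∧
    ((1 : Matrix V V ℝ) - rwKernelMatrix G V).det ≠ 0 ∧
    Real.exp (rwLoopMass G (↑B : Set (Site 2))) * ((1 : Matrix V V ℝ) - rwKernelMatrix G V).det =
      ((1 : Matrix ↥(V \ B) ↥(V \ B) ℝ) - rwKernelMatrix G (V \ B)).det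

/-- Unfolding lemma. [folklore] -/
theorem Lawler2018_exp_rwLoopMass_eq_det_ratio_iff :
    Lawler2018_exp_rwLoopMass_eq_det_ratio ↔
      ∀ (G : SimpleGraph (Site 2)) (V B : Finset (Site 2)),
        G ≤ zdGraph 2 → (∀ x y : Site 2, G.Adj x y → x ∈ V ∧ y ∈ V) → B ⊆ V →
        Summable (rwLoopTerm G (↑B : Set (Site 2))) ∧
        ((1 : Matrix V V ℝ) - rwKernelMatrix G V).det ≠ 0 ∧
        Real.exp (rwLoopMass G (↑B : Set (Site 2))) * ((1 : Matrix V V ℝ) - rwKernelMatrix G V).det =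
          ((1 : Matrix ↥(V \ B) ↥(V \ B) ℝ) - rwKernelMatrix G (V \ B)).det :=
  Iff.rfl

/-- **The printed ratio form**: under the fact, `exp m[ℒ(V; B)] = det(I − Q_{V∖B}) / det(I − Q_V)`
(Lawler's `F_B(A) = F(A)/F(A∖B)` with `F = 1/det(I − Q)`). [cite: Lawler2018, Proposition 5.2 and Proposition 3.5] -/
theorem Lawler2018_exp_rwLoopMass_eq_det_ratio.exp_eq_div
    (h : Lawler2018_exp_rwLoopMass_eq_det_ratio)
    {G : SimpleGraph (Site 2)} {V B : Finset (Site 2)} (hG : G ≤ zdGraph 2)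
    (hV : ∀ x y : Site 2, G.Adj x y → x ∈ V ∧ y ∈ V) (hB : B ⊆ V) :
    Real.exp (rwLoopMass G (↑B : Set (Site 2))) =
      ((1 : Matrix ↥(V \ B) ↥(V \ B) ℝ) - rwKernelMatrix G (V \ B)).det /
        ((1 : Matrix V V ℝ) - rwKernelMatrix G V).det := by
  obtain ⟨-, hdet, hmul⟩ := h G V B hG hV hB
  rw [eq_div_iff hdet, hmul]

/-- **`B = V` (all loops): `exp m[ℒ(V)] · det(I − Q_V) = 1`**, i.e. `F(A) = 1/det(I − Q)`
(Prop. 3.5), since the kernel on the empty vertex set is the empty matrix of determinant `1`.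
[cite: Lawler2018, Proposition 3.5] -/
theorem Lawler2018_exp_rwLoopMass_eq_det_ratio.exp_mul_det_self
    (h : Lawler2018_exp_rwLoopMass_eq_det_ratio)
    {G : SimpleGraph (Site 2)} {V : Finset (Site 2)} (hG : G ≤ zdGraph 2)
    (hV : ∀ x y : Site 2, G.Adj x y → x ∈ V ∧ y ∈ V) :
    Real.exp (rwLoopMass G (↑V : Set (Site 2))) * ((1 : Matrix V V ℝ) - rwKernelMatrix G V).det = 1 := by
  obtain ⟨-, -, hmul⟩ := h G V V hG hV subset_rfl
  rw [hmul]
  haveI : IsEmpty ↥(V \ V) := by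
    refine ⟨fun x => ?_⟩
    have hx := x.2
    simp at hx
  exact Matrix.det_isEmpty

end Literature.Probability.LatticeModels

end

/-!
## Proof of `Lawler2018_exp_rwLoopMass_eq_det_ratio` (discharge, literature-prover 2026-08-15)

Architecture (Lawler 2018, proof of Prop. 5.2 / Prop. 3.5, reorganised through the trace; every
step below is proved, nothing is assumed):

1. *Paths and matrix powers* (Lawler 2018 §2 p. 6: "the `q`-measure of the set of walks of
   length `n` in `𝒦_A(x,y)` is the same as the `(x,y)` entry of the matrix `Qⁿ`"): for the kernel
   `Q_S = rwKernelMatrix G S = ¼ · adjMatrix (G|S)` one has `(Q_Sⁿ)_{xy} = 4⁻ⁿ · #{walks x → y of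
   length n inside S}` (`RWLoopDet.rwKernelMatrix_pow_apply`, via Mathlib's
   `SimpleGraph.adjMatrix_pow_apply_eq_card_walk` on the finite induced graph `RWLoopDet.finInduce`
   and the walk lifts `RWLoopDet.ofFin` / `RWLoopDet.toFin`).
2. Hence the rooted loop measure of the loops of positive length *inside* `S` (Def. 8: weight
   `q(l)/|l|`) is `Σ_{n ≥ 1} tr(Q_Sⁿ)/n` (`RWLoopDet.tsum_ofReal_loopTermIn`, computed in `ℝ≥0∞`).
3. *Spectral calculus* (the "Taylor series for the logarithm" of the remark after Prop. 5.2, applied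
   to the symmetric matrix `Q_S` through Mathlib's spectral theorem
   `Matrix.IsHermitian.spectral_theorem`): if every eigenvalue of `Q_S` has modulus `< 1` then
   `Σ_{n≥1} tr(Q_Sⁿ)/n = -log det(I - Q_S)` and `det(I - Q_S) > 0`
   (`RWLoopDet.hasSum_trace_pow_div`, `RWLoopDet.det_one_sub_pos`).
4. *Integrability is automatic on `ℤ²`* (the module docstring's remark): for `G ≤ zdGraph 2` and
   `S` finite every real eigenvalue of `Q_S` has modulus `< 1` — maximum-modulus argument at a
   maximiser of `|v|` with maximal first coordinate, whose right neighbour cannot be a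
   `G`-neighbour of full modulus (`RWLoopDet.abs_lt_one_of_mulVec_eq`).
5. *Loops meeting `B`* = (loops inside `V`) − (loops inside `V ∖ B`) termwise
   (`RWLoopDet.rwLoopTerm_split`; every loop of positive length lies in `V` because all edges do),
   so `m[ℒ(V; B)] = log det(I − Q_{V∖B}) − log det(I − Q_V)`, which exponentiates to the fact
   (`RWLoopDet.summable_rwLoopTerm_and_tsum_eq`). This replaces Lawler's route through
   Prop. 5.1 (re-rooting at `x`), `F_B(A) = ∏ G_{A_j}(x_j,x_j)` and Cramer's rule (proof of
   Prop. 3.5) by the equivalent trace bookkeeping `m[ℒ(A;B)] = Σ_n n⁻¹ (tr Q_Aⁿ − tr Q_{A∖B}ⁿ)`,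
   which is shorter to formalize and order-independent from the start.
-/

noncomputable section

namespace Literature.Probability.LatticeModels

namespace RWLoopDet

open Matrix Finset SimpleGraph
open scoped ENNReal Classical

/-! ### 1. Spectral calculus for a real symmetric matrix with spectrum in `(-1, 1)` -/

section Spectral

variable {n : Type*} [Fintype n] [DecidableEq n] {Q : Matrix n n ℝ}

/-- `Qᵏ = U Λᵏ Uᵀ` for a real symmetric `Q = U Λ Uᵀ` (Mathlib's spectral theorem). [folklore] -/
theorem pow_eq_conj (hQ : Q.IsHermitian) (k : ℕ) :
    Q ^ k = (hQ.eigenvectorUnitary : Matrix n n ℝ) * diagonal (fun i => hQ.eigenvalues i ^ k) *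
      star (hQ.eigenvectorUnitary : Matrix n n ℝ) := by
  have h := hQ.spectral_theorem
  have e : (RCLike.ofReal ∘ hQ.eigenvalues : n → ℝ) = hQ.eigenvalues := by
    funext i; simp
  rw [e] at h
  have : Q ^ k = Unitary.conjStarAlgAut ℝ _ hQ.eigenvectorUnitary (diagonal hQ.eigenvalues ^ k) := by
    rw [map_pow, ← h]
  rw [this, Unitary.conjStarAlgAut_apply, diagonal_pow]
  rfl

/-- `tr Qᵏ = Σᵢ λᵢᵏ`. [folklore] -/
theorem trace_pow (hQ : Q.IsHermitian) (k : ℕ) : (Q ^ k).trace = ∑ i, hQ.eigenvalues i ^ k := by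
  have hU : star (hQ.eigenvectorUnitary : Matrix n n ℝ) * (hQ.eigenvectorUnitary : Matrix n n ℝ) = 1 :=
    Unitary.star_mul_self_of_mem hQ.eigenvectorUnitary.prop
  rw [pow_eq_conj hQ k, trace_mul_cycle, hU, Matrix.one_mul, trace_diagonal]

/-- `I - Q = U (I - Λ) Uᵀ`. [folklore] -/
theorem one_sub_eq_conj (hQ : Q.IsHermitian) :
    1 - Q = (hQ.eigenvectorUnitary : Matrix n n ℝ) * diagonal (fun i => 1 - hQ.eigenvalues i) *
      star (hQ.eigenvectorUnitary : Matrix n n ℝ) := by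
  have h := hQ.spectral_theorem
  have e : (RCLike.ofReal ∘ hQ.eigenvalues : n → ℝ) = hQ.eigenvalues := by
    funext i; simp
  rw [e] at h
  have : 1 - Q = Unitary.conjStarAlgAut ℝ _ hQ.eigenvectorUnitary (1 - diagonal hQ.eigenvalues) := by
    rw [map_sub, map_one, ← h]
  rw [this, Unitary.conjStarAlgAut_apply, ← diagonal_one, diagonal_sub]

/-- `det(I - Q) = ∏ᵢ (1 - λᵢ)`. [folklore] -/
theorem det_one_sub (hQ : Q.IsHermitian) : (1 - Q).det = ∏ i, (1 - hQ.eigenvalues i) := by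
  have hU' : (hQ.eigenvectorUnitary : Matrix n n ℝ) * star (hQ.eigenvectorUnitary : Matrix n n ℝ) = 1 :=
    Unitary.mul_star_self_of_mem hQ.eigenvectorUnitary.prop
  rw [one_sub_eq_conj hQ, det_mul, det_mul, mul_comm (det _) (det (diagonal _)), mul_assoc,
    ← det_mul, hU', det_one, mul_one, det_diagonal]

/-- If all eigenvalues have modulus `< 1` then `det(I - Q) > 0`. [folklore] -/
theorem det_one_sub_pos (hQ : Q.IsHermitian) (hb : ∀ i, |hQ.eigenvalues i| < 1) :
    0 < (1 - Q).det := by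
  rw [det_one_sub hQ]
  refine Finset.prod_pos fun i _ => ?_
  have := hb i
  rw [abs_lt] at this
  linarith

/-- **`Σ_{k ≥ 1} tr(Qᵏ)/k = -log det(I - Q)`** for a real symmetric `Q` with spectrum in `(-1,1)`
(the logarithmic series `-log(1-λ) = Σ λᵏ/k` eigenvalue by eigenvalue). [folklore] -/
theorem hasSum_trace_pow_div (hQ : Q.IsHermitian) (hb : ∀ i, |hQ.eigenvalues i| < 1) :
    HasSum (fun k : ℕ => (Q ^ (k + 1)).trace / (k + 1)) (-Real.log ((1 - Q).det)) := by
  simp_rw [trace_pow hQ, Finset.sum_div]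
  rw [det_one_sub hQ, Real.log_prod (fun i _ => ?_)]
  · rw [← Finset.sum_neg_distrib]
    exact hasSum_sum fun i _ => Real.hasSum_pow_div_log_of_abs_lt_one (hb i)
  · have := hb i
    rw [abs_lt] at this
    linarith

end Spectral

/-! ### 2. Walks of `G` inside a finite set `S` and powers of `rwKernelMatrix G S` -/

variable (G : SimpleGraph (Site 2)) (S : Finset (Site 2))

/-- The subgraph of `G` induced on the finset `S`, as a graph on the subtype `↥S`
(Mathlib's `SimpleGraph.induce`, but indexed by the `Finset` subtype that indexes
`rwKernelMatrix`). [folklore] -/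
abbrev finInduce : SimpleGraph S := G.comap (Function.Embedding.subtype (· ∈ S))

/-- Adjacency in `finInduce G S` is adjacency in `G`. [folklore] -/
theorem finInduce_adj {a b : S} : (finInduce G S).Adj a b ↔ G.Adj a b := Iff.rfl

/-- `rwKernelMatrix` is symmetric, i.e. Hermitian over `ℝ` (`q(x,y) = q(y,x)`, a symmetric weight,
Lawler 2018 §2). [cite: Lawler2018, §2 (symmetric weights)] -/
theorem isHermitian_rwKernelMatrix : (rwKernelMatrix G S).IsHermitian := by
  ext x y
  simp only [conjTranspose_apply, rwKernelMatrix_apply, star_trivial, G.adj_comm]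

/-- `Q_S = ¼ · (adjacency matrix of G|S)`. [cite: Lawler2018, §2 (Type II simple random walk)] -/
theorem rwKernelMatrix_eq_smul_adjMatrix :
    rwKernelMatrix G S = (1 / 4 : ℝ) • (finInduce G S).adjMatrix ℝ := by
  ext x y
  simp [rwKernelMatrix_apply, adjMatrix_apply]

/-- **"The `q`-measure of the walks of length `n` from `x` to `y` in `S` is `(Qⁿ)_{xy}`"**
(Lawler 2018, §2, p. 6), here `4⁻ⁿ · #{walks of length n}`.
[cite: Lawler2018, §2 (p. 6, walks of length n and Qⁿ)] -/
theorem rwKernelMatrix_pow_apply (k : ℕ) (x y : S) :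
    (rwKernelMatrix G S ^ k) x y =
      (1 / 4 : ℝ) ^ k * ((finInduce G S).finsetWalkLength k x y).card := by
  rw [rwKernelMatrix_eq_smul_adjMatrix, smul_pow, Matrix.smul_apply,
    adjMatrix_pow_apply_eq_card_walk, card_set_walk_length_eq, smul_eq_mul]

/-- Entries of `Q_Sᵏ` are nonnegative. [folklore] -/
theorem rwKernelMatrix_pow_apply_nonneg (k : ℕ) (x y : S) : 0 ≤ (rwKernelMatrix G S ^ k) x y := by
  rw [rwKernelMatrix_pow_apply]
  positivity

/-- `tr Q_Sᵏ ≥ 0`. [folklore] -/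
theorem trace_rwKernelMatrix_pow_nonneg (k : ℕ) : 0 ≤ (rwKernelMatrix G S ^ k).trace :=
  Finset.sum_nonneg fun x _ => rwKernelMatrix_pow_apply_nonneg G S k x x

variable {G S}

/-- A walk of the induced graph on `S`, read back in `G` (cf. `SimpleGraph.Walk.map`). [folklore] -/
def ofFin : ∀ {a b : S}, (finInduce G S).Walk a b → G.Walk a.1 b.1
  | _, _, Walk.nil => Walk.nil
  | _, _, Walk.cons h q => Walk.cons ((finInduce_adj G S).1 h) (ofFin q)

/-- `ofFin nil = nil`. [folklore] -/
@[simp] theorem ofFin_nil (a : S) :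
    ofFin (S := S) (Walk.nil : (finInduce G S).Walk a a) = Walk.nil := rfl

/-- `ofFin (cons h q) = cons h (ofFin q)`. [folklore] -/
@[simp] theorem ofFin_cons {a b c : S} (h : (finInduce G S).Adj a b)
    (q : (finInduce G S).Walk b c) :
    ofFin (Walk.cons h q) = Walk.cons ((finInduce_adj G S).1 h) (ofFin q) := rfl

/-- `ofFin` preserves length. [folklore] -/
@[simp] theorem length_ofFin {a b : S} (q : (finInduce G S).Walk a b) :
    (ofFin q).length = q.length := by
  induction q with
  | nil => rfl
  | cons h q ih => simp [ih]

/-- The support of `ofFin q` is the support of `q`. [folklore] -/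
theorem support_ofFin {a b : S} (q : (finInduce G S).Walk a b) :
    (ofFin q).support = q.support.map Subtype.val := by
  induction q with
  | nil => rfl
  | cons h q ih => simp [ih]

/-- The support of `ofFin q` lies in `S`. [folklore] -/
theorem mem_of_mem_support_ofFin {a b : S} {q : (finInduce G S).Walk a b} {x : Site 2}
    (hx : x ∈ (ofFin q).support) : x ∈ S := by
  rw [support_ofFin, List.mem_map] at hx
  obtain ⟨y, -, rfl⟩ := hx
  exact y.2

/-- A walk of `G` inside `S` lifts to the induced graph on `S` (cf. `SimpleGraph.Walk.induce`).
[folklore] -/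
def toFin : ∀ {u v : Site 2} (w : G.Walk u v) (hw : ∀ x ∈ w.support, x ∈ S),
    (finInduce G S).Walk ⟨u, hw _ w.start_mem_support⟩ ⟨v, hw _ w.end_mem_support⟩
  | _, _, Walk.nil, _ => Walk.nil
  | _, _, Walk.cons huu' w, hw =>
    Walk.cons ((finInduce_adj G S).2 huu') (toFin w fun x hx => hw x (by simp [hx]))

/-- `toFin nil = nil`. [folklore] -/
@[simp] theorem toFin_nil {u : Site 2} (hw) :
    toFin (S := S) (Walk.nil : G.Walk u u) hw = Walk.nil := rfl

/-- `toFin (cons h w) = cons h (toFin w)`. [folklore] -/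
@[simp] theorem toFin_cons {u u' v : Site 2} (huu' : G.Adj u u') (w : G.Walk u' v) (hw) :
    toFin (S := S) (Walk.cons huu' w) hw =
      Walk.cons ((finInduce_adj G S).2 huu') (toFin w fun x hx => hw x (by simp [hx])) := rfl

/-- `ofFin ∘ toFin = id`. [folklore] -/
theorem ofFin_toFin {u v : Site 2} (p : G.Walk u v) (hp : ∀ x ∈ p.support, x ∈ S) :
    ofFin (toFin p hp) = p := by
  induction p with
  | nil => rfl
  | cons h q ih => simp [ih]

/-- `ofFin` is injective (cf. `SimpleGraph.Walk.map_injective_of_injective`). [folklore] -/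
theorem ofFin_injective {a b : S} :
    Function.Injective (ofFin : (finInduce G S).Walk a b → G.Walk a.1 b.1) := by
  intro p p' h
  induction p with
  | nil => cases p' <;> simp at h ⊢
  | cons h₁ q ih =>
    cases p' with
    | nil => simp at h
    | cons h₂ q' =>
      simp only [ofFin_cons, Walk.cons.injEq] at h
      obtain ⟨h1, h2⟩ := h
      cases Subtype.ext h1
      rw [ih (eq_of_heq h2)]

variable (G S)

/-- Transport of a series over the walks of `G` contained in `S` to the induced graph on `S`.
[folklore] -/
theorem tsum_walk_eq_tsum_fin (u v : S) (F : G.Walk u v → ℝ≥0∞)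
    (hF : ∀ p, F p ≠ 0 → ∀ x ∈ p.support, x ∈ S) :
    ∑' p, F p = ∑' q : (finInduce G S).Walk u v, F (ofFin q) := by
  symm
  refine Function.Injective.tsum_eq
    (g := (ofFin : (finInduce G S).Walk u v → G.Walk u v)) ofFin_injective ?_
  intro p hp
  have hsub : ∀ x ∈ p.support, x ∈ S := hF p hp
  exact ⟨toFin p hsub, ofFin_toFin p hsub⟩

/-- Counting the walks of a given length in a finite graph, as a series. [folklore] -/
theorem tsum_ite_length {W : Type*} [Fintype W] [DecidableEq W] (H : SimpleGraph W)
    [DecidableRel H.Adj] (a b : W) (k : ℕ) (r : ℝ≥0∞) :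
    ∑' q : H.Walk a b, (if k = q.length then r else 0) = (H.finsetWalkLength k a b).card * r := by
  rw [tsum_eq_sum (s := H.finsetWalkLength k a b)]
  · rw [Finset.sum_congr rfl fun q hq => if_pos (mem_finsetWalkLength_iff.1 hq).symm, sum_const,
      nsmul_eq_mul]
  · intro q hq
    exact if_neg fun h => hq (mem_finsetWalkLength_iff.2 h.symm)

/-- The series over the loops at `x ∈ S` staying inside `S`, organised by length. [folklore] -/
theorem tsum_loops_at (x : S) (g : ℕ → ℝ≥0∞) :
    ∑' p : G.Walk x x, (if (∀ v ∈ p.support, v ∈ S) then g p.length else 0) =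
      ∑' k, ((finInduce G S).finsetWalkLength k x x).card * g k := by
  rw [tsum_walk_eq_tsum_fin G S x x]
  · have : ∀ q : (finInduce G S).Walk x x,
        (if (∀ v ∈ (ofFin q).support, v ∈ S) then g (ofFin q).length else 0) =
        ∑' k, (if k = q.length then g k else 0) := by
      intro q
      rw [tsum_ite_eq, length_ofFin, if_pos]
      intro v hv
      exact mem_of_mem_support_ofFin hv
    simp_rw [this]
    rw [ENNReal.tsum_comm]
    simp_rw [tsum_ite_length]
  · intro p hp
    by_contra h
    exact hp (if_neg h)

/-! ### 3. The loop measure of the loops inside `S`: `Σ_{n≥1} tr(Q_Sⁿ)/n = -log det(I - Q_S)` -/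

/-- The rooted-loop-measure weight `m̃(l) = q(l)/|l| = 4^{-|l|}/|l|` (Lawler 2018, Def. 8) of a
rooted loop of `G` of positive length lying inside `S`, and `0` otherwise.
[cite: Lawler2018, Definition 8] -/
def loopTermIn (p : Σ x, G.Walk x x) : ℝ :=
  if 0 < p.2.length ∧ (∀ v ∈ p.2.support, v ∈ S) then
    ((1 : ℝ) / 4) ^ p.2.length / (p.2.length : ℝ) else 0

/-- `loopTermIn ≥ 0`. [folklore] -/
theorem loopTermIn_nonneg (p : Σ x, G.Walk x x) : 0 ≤ loopTermIn G S p := by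
  unfold loopTermIn
  split_ifs <;> positivity

/-- **`m̃[loops inside S] = -log det(I - Q_S)`** (Lawler 2018, Prop. 5.2, last display:
`exp{m[ℒ(A)]} = 1/det[I - Q]`), in `ℝ≥0∞`, under the spectral condition; proved through
`Σ_l m̃(l) = Σ_{n ≥ 1} tr(Q_Sⁿ)/n`. [cite: Lawler2018, Proposition 5.2] -/
theorem tsum_ofReal_loopTermIn
    (hb : ∀ i, |(isHermitian_rwKernelMatrix G S).eigenvalues i| < 1) :
    ∑' p : Σ x, G.Walk x x, ENNReal.ofReal (loopTermIn G S p) =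
      ENNReal.ofReal (-Real.log ((1 - rwKernelMatrix G S).det)) := by
  set K := rwKernelMatrix G S with hKdef
  have hK := isHermitian_rwKernelMatrix G S
  -- the length profile
  set g : ℕ → ℝ≥0∞ := fun k => if 0 < k then ENNReal.ofReal (((1 : ℝ) / 4) ^ k / (k : ℝ)) else 0
    with hgdef
  have hterm : ∀ (x : Site 2) (p : G.Walk x x), ENNReal.ofReal (loopTermIn G S ⟨x, p⟩) =
      if (∀ v ∈ p.support, v ∈ S) then g p.length else 0 := by
    intro x p
    simp only [loopTermIn, hgdef]
    by_cases h1 : ∀ v ∈ p.support, v ∈ S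
    · by_cases h2 : 0 < p.length
      · rw [if_pos ⟨h2, h1⟩, if_pos h1, if_pos h2]
      · rw [if_neg (fun h => h2 h.1), if_pos h1, if_neg h2, ENNReal.ofReal_zero]
    · rw [if_neg (fun h => h1 h.2), if_neg h1, ENNReal.ofReal_zero]
  rw [ENNReal.tsum_sigma']
  rw [tsum_eq_sum (s := S)]
  swap
  · intro x hx
    refine ENNReal.tsum_eq_zero.2 fun p => ?_
    rw [hterm, if_neg]
    intro h
    exact hx (h x p.start_mem_support)
  -- inner sums over `x ∈ S`
  have hinner : ∀ x : S, ∑' p : G.Walk x x, ENNReal.ofReal (loopTermIn G S ⟨x, p⟩) =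
      ∑' k, ((finInduce G S).finsetWalkLength k x x).card * g k := by
    intro x
    simp_rw [hterm]
    exact tsum_loops_at G S x g
  rw [← Finset.sum_coe_sort S, Fintype.sum_congr _ _ hinner,
    ← Summable.tsum_finsetSum (fun _ _ => ENNReal.summable)]
  -- identify the finite sums with traces
  have htrace : ∀ k, ∑ x : S, (((finInduce G S).finsetWalkLength k x x).card : ℝ≥0∞) * g k =
      if 0 < k then ENNReal.ofReal ((K ^ k).trace / (k : ℝ)) else 0 := by
    intro k
    by_cases hk : 0 < k
    · simp only [hgdef, if_pos hk]
      have : ∀ x : S, (((finInduce G S).finsetWalkLength k x x).card : ℝ≥0∞) *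
          ENNReal.ofReal (((1 : ℝ) / 4) ^ k / (k : ℝ)) =
          ENNReal.ofReal ((K ^ k) x x / (k : ℝ)) := by
        intro x
        rw [hKdef, rwKernelMatrix_pow_apply, ← ENNReal.ofReal_natCast,
          ← ENNReal.ofReal_mul (by positivity)]
        congr 1
        ring
      rw [Fintype.sum_congr _ _ this, ← ENNReal.ofReal_sum_of_nonneg, ← Finset.sum_div]
      · rfl
      · intro x _
        exact div_nonneg (rwKernelMatrix_pow_apply_nonneg G S k x x) (by positivity)
    · simp only [hgdef, if_neg hk, mul_zero, Finset.sum_const_zero]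
  simp_rw [htrace]
  rw [tsum_eq_zero_add' ENNReal.summable, if_neg (lt_irrefl 0), zero_add]
  simp only [Nat.succ_pos, if_true]
  rw [← (hasSum_trace_pow_div hK hb).tsum_eq,
    ENNReal.ofReal_tsum_of_nonneg _ (hasSum_trace_pow_div hK hb).summable]
  · refine tsum_congr fun j => ?_
    push_cast
    rfl
  · intro j
    exact div_nonneg (trace_rwKernelMatrix_pow_nonneg G S _) (by positivity)

/-- The loop measure of the loops inside `S`, `-log det(I - Q_S) = Σ_{n≥1} tr(Q_Sⁿ)/n`, is
nonnegative. [folklore] -/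
theorem neg_log_det_nonneg (hb : ∀ i, |(isHermitian_rwKernelMatrix G S).eigenvalues i| < 1) :
    0 ≤ -Real.log ((1 - rwKernelMatrix G S).det) :=
  (hasSum_trace_pow_div (isHermitian_rwKernelMatrix G S) hb).nonneg fun j =>
    div_nonneg (trace_rwKernelMatrix_pow_nonneg G S _) (by positivity)

/-! ### 4. Loops meeting `B` = loops inside `V` minus loops inside `V ∖ B` -/

variable {G}
variable {A : Finset (Site 2)}

/-- A walk of positive length starts in `A` (all edges of `G` lie in `A`). [folklore] -/
theorem start_mem_of_length_pos (hA : ∀ x y : Site 2, G.Adj x y → x ∈ A) {u v : Site 2}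
    (p : G.Walk u v) (hp : 0 < p.length) : u ∈ A := by
  cases p with
  | nil => simp at hp
  | cons h _ => exact hA _ _ h

/-- A walk starting in `A` stays in `A` (all edges of `G` lie in `A`). [folklore] -/
theorem support_subset_of_start_mem (hA : ∀ x y : Site 2, G.Adj x y → x ∈ A) {u v : Site 2}
    (p : G.Walk u v) (hu : u ∈ A) : ∀ y ∈ p.support, y ∈ A := by
  induction p with
  | nil => simpa using hu
  | cons h q ih =>
    intro y hy
    rw [Walk.support_cons, List.mem_cons] at hy
    rcases hy with rfl | hy
    · exact hu
    · exact ih (hA _ _ h.symm) y hy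

/-- Every loop of positive length lies in `A` (all edges of `G` lie in `A`). [folklore] -/
theorem support_subset_of_length_pos (hA : ∀ x y : Site 2, G.Adj x y → x ∈ A) {u v : Site 2}
    (p : G.Walk u v) (hp : 0 < p.length) : ∀ y ∈ p.support, y ∈ A :=
  support_subset_of_start_mem hA p (start_mem_of_length_pos hA p hp)

/-- **Termwise splitting**: for a rooted loop, (meets `B`) + (inside `A ∖ B`) = (inside `A`), for
the weights `m̃(l)`; i.e. `ℒ(A) = ℒ(A; B) ⊔ ℒ(A ∖ B)` (Lawler 2018, §5.1). [cite: Lawler2018, §5.1 (Definition 9–10, ℒ(A;B))] -/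
theorem rwLoopTerm_split (hA : ∀ x y : Site 2, G.Adj x y → x ∈ A) (B : Finset (Site 2))
    (p : Σ x, G.Walk x x) :
    ENNReal.ofReal (rwLoopTerm G (↑B) p) + ENNReal.ofReal (loopTermIn G (A \ B) p) =
      ENNReal.ofReal (loopTermIn G A p) := by
  unfold rwLoopTerm loopTermIn
  by_cases h0 : 0 < p.2.length
  · have hsupp := support_subset_of_length_pos hA p.2 h0
    by_cases hm : ∃ v ∈ p.2.support, v ∈ (B : Set (Site 2))
    · rw [if_pos ⟨h0, hm⟩, if_neg, if_pos ⟨h0, hsupp⟩, ENNReal.ofReal_zero, add_zero]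
      rintro ⟨-, hall⟩
      obtain ⟨v, hv, hvB⟩ := hm
      exact (Finset.mem_sdiff.1 (hall v hv)).2 (Finset.mem_coe.1 hvB)
    · rw [if_neg (fun h => hm h.2), if_pos, if_pos ⟨h0, hsupp⟩, ENNReal.ofReal_zero, zero_add]
      refine ⟨h0, fun v hv => Finset.mem_sdiff.2 ⟨hsupp v hv, fun hvB => hm ⟨v, hv, ?_⟩⟩⟩
      exact Finset.mem_coe.2 hvB
  · rw [if_neg (fun h => h0 h.1), if_neg (fun h => h0 h.1), if_neg (fun h => h0 h.1),
      ENNReal.ofReal_zero, add_zero]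

/-- **Core identity** (Lawler 2018, Prop. 5.2 with Prop. 3.5: `exp m[ℒ(A;B)] = F_B(A) =
F(A)/F(A∖B)`, `F = 1/det(I-Q)`), logarithmic form: the loop series of the loops meeting `B` is
summable and equals `log det(I − Q_{A∖B}) − log det(I − Q_A)`, under the spectral conditions.
[cite: Lawler2018, Proposition 5.2 and Proposition 3.5] -/
theorem summable_rwLoopTerm_and_tsum_eq (hA : ∀ x y : Site 2, G.Adj x y → x ∈ A) (B : Finset (Site 2))
    (hbA : ∀ i, |(isHermitian_rwKernelMatrix G A).eigenvalues i| < 1)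
    (hbAB : ∀ i, |(isHermitian_rwKernelMatrix G (A \ B)).eigenvalues i| < 1) :
    Summable (rwLoopTerm G (↑B)) ∧
      ∑' p, rwLoopTerm G (↑B) p =
        -Real.log ((1 - rwKernelMatrix G A).det) - -Real.log ((1 - rwKernelMatrix G (A \ B)).det) := by
  set vA := -Real.log ((1 - rwKernelMatrix G A).det)
  set vAB := -Real.log ((1 - rwKernelMatrix G (A \ B)).det)
  set M := ∑' p, ENNReal.ofReal (rwLoopTerm G (↑B) p) with hM
  have hsum : M + ENNReal.ofReal vAB = ENNReal.ofReal vA := by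
    rw [hM, ← tsum_ofReal_loopTermIn G (A \ B) hbAB, ← tsum_ofReal_loopTermIn G A hbA,
      ← ENNReal.tsum_add]
    exact tsum_congr (rwLoopTerm_split hA B)
  have hMeq : ENNReal.ofReal vA - ENNReal.ofReal vAB = M :=
    ENNReal.sub_eq_of_eq_add ENNReal.ofReal_ne_top hsum.symm
  have hMtop : M ≠ ⊤ := by
    rw [← hMeq]
    exact ENNReal.sub_ne_top ENNReal.ofReal_ne_top
  have hle : ENNReal.ofReal vAB ≤ ENNReal.ofReal vA := by
    rw [← hsum]
    exact le_add_self
  have h1 : ∀ p, (ENNReal.ofReal (rwLoopTerm G (↑B) p)).toReal = rwLoopTerm G (↑B) p := fun p =>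
    ENNReal.toReal_ofReal (rwLoopTerm_nonneg G (↑B) p)
  refine ⟨?_, ?_⟩
  · have := ENNReal.summable_toReal hMtop
    simpa only [h1] using this
  · calc ∑' p, rwLoopTerm G (↑B) p = ∑' p, (ENNReal.ofReal (rwLoopTerm G (↑B) p)).toReal := by
          simp_rw [h1]
      _ = M.toReal := (ENNReal.tsum_toReal_eq fun _ => ENNReal.ofReal_ne_top).symm
      _ = vA - vAB := by
          rw [← hMeq, ENNReal.toReal_sub_of_le hle ENNReal.ofReal_ne_top,
            ENNReal.toReal_ofReal (neg_log_det_nonneg G A hbA),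
            ENNReal.toReal_ofReal (neg_log_det_nonneg G (A \ B) hbAB)]

/-! ### 5. Integrability is automatic on `ℤ²`: the max-modulus bound -/

/-- The `G`-neighbours of `x₀` inside `S` number at most `4`, and if they number `4` then the
right lattice neighbour `x₀ + e₀` is one of them (`G ≤ ℤ²`). [folklore] -/
theorem card_neighbours_le (hG : G ≤ zdGraph 2) (x₀ : S) :
    (univ.filter fun y : S => G.Adj x₀ y).card ≤ 4 ∧
      ((univ.filter fun y : S => G.Adj x₀ y).card = 4 →
        ∃ y : S, G.Adj x₀ y ∧ (y : Site 2) = (x₀ : Site 2) + Pi.single 0 1) := by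
  set N := univ.filter fun y : S => G.Adj x₀ y with hN
  set L : Finset (Site 2) := (univ : Finset (Fin 2 × Bool)).image fun p =>
    if p.2 then (x₀ : Site 2) + Pi.single p.1 1 else (x₀ : Site 2) - Pi.single p.1 1 with hL
  have hLcard : L.card ≤ 4 := by
    refine (card_image_le).trans ?_
    simp
  have hsub : N.map (Function.Embedding.subtype (· ∈ S)) ⊆ L := by
    intro z hz
    rw [Finset.mem_map] at hz
    obtain ⟨y, hy, rfl⟩ := hz
    rw [hN, Finset.mem_filter] at hy
    have hadj : (zdGraph 2).Adj (x₀ : Site 2) y := hG hy.2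
    rw [zdGraph_adj_iff] at hadj
    obtain ⟨i, h | h⟩ := hadj
    · exact Finset.mem_image.2 ⟨(i, true), mem_univ _, by simp [h]⟩
    · exact Finset.mem_image.2 ⟨(i, false), mem_univ _, by simp [h]⟩
  have hNcard : N.card = (N.map (Function.Embedding.subtype (· ∈ S))).card := (card_map _).symm
  refine ⟨?_, fun h4 => ?_⟩
  · rw [hNcard]
    exact (card_le_card hsub).trans hLcard
  · have heq : N.map (Function.Embedding.subtype (· ∈ S)) = L :=
      Finset.eq_of_subset_of_card_le hsub (by rw [← hNcard, h4]; exact hLcard)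
    have hr : (x₀ : Site 2) + Pi.single 0 1 ∈ L :=
      Finset.mem_image.2 ⟨((0 : Fin 2), true), mem_univ _, by simp⟩
    rw [← heq, Finset.mem_map] at hr
    obtain ⟨y, hy, hyr⟩ := hr
    rw [hN, Finset.mem_filter] at hy
    exact ⟨y, hy.2, hyr⟩

/-- **Max-modulus bound** ("integrability is automatic", module docstring): for a subgraph `G` of
`ℤ²` and a finite `S`, every real eigenvalue of `Q_S = ¼·[x ∼ y]_{x,y ∈ S}` has modulus `< 1` — at
a maximiser `x₀` of `|v|` with maximal first coordinate, `|μ| |v(x₀)| ≤ ¼ Σ_{y ∼ x₀} |v(y)| ≤ |v(x₀)|`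
with equality only if `x₀` has four `G`-neighbours of full modulus, including `x₀ + e₀`.
[folklore] -/
theorem abs_lt_one_of_mulVec_eq (hG : G ≤ zdGraph 2) {v : S → ℝ} {μ : ℝ} (hv : v ≠ 0)
    (h : rwKernelMatrix G S *ᵥ v = μ • v) : |μ| < 1 := by
  -- a vertex maximising `|v|`
  obtain ⟨x₁, hx₁⟩ := Function.ne_iff.1 hv
  haveI : Nonempty S := ⟨x₁⟩
  obtain ⟨xm, hxm⟩ := Finite.exists_max fun x : S => |v x|
  set m := |v xm| with hm
  have hmpos : 0 < m := lt_of_lt_of_le (abs_pos.2 hx₁) (hxm x₁)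
  -- among the maximisers, one with maximal first coordinate
  set M := univ.filter fun x : S => |v x| = m with hM
  have hMne : M.Nonempty := ⟨xm, Finset.mem_filter.2 ⟨mem_univ _, rfl⟩⟩
  obtain ⟨x₀, hx₀M, hx₀max⟩ := Finset.exists_max_image M (fun x : S => (x : Site 2) 0) hMne
  have hx₀ : |v x₀| = m := (Finset.mem_filter.1 hx₀M).2
  -- the eigen-equation at `x₀`
  obtain ⟨hN4, hright⟩ := card_neighbours_le S hG x₀
  set N := univ.filter fun y : S => G.Adj x₀ y with hN
  have heq : μ * v x₀ = ∑ y ∈ N, (1 / 4 : ℝ) * v y := by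
    have := congrFun h x₀
    simp only [Pi.smul_apply, smul_eq_mul] at this
    rw [← this, mulVec, dotProduct, hN, Finset.sum_filter]
    refine Finset.sum_congr rfl fun y _ => ?_
    simp only [rwKernelMatrix_apply]
    split_ifs <;> simp
  have hquarter : ∀ y : S, |(1 / 4 : ℝ) * v y| = |v y| / 4 := fun y => by
    rw [abs_mul, abs_of_pos (by norm_num : (0 : ℝ) < 1 / 4)]
    ring
  have h2 : |μ| * m ≤ ∑ y ∈ N, |v y| / 4 := by
    calc |μ| * m = |μ * v x₀| := by rw [abs_mul, hx₀]
      _ = |∑ y ∈ N, (1 / 4 : ℝ) * v y| := by rw [heq]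
      _ ≤ ∑ y ∈ N, |(1 / 4 : ℝ) * v y| := abs_sum_le_sum_abs _ _
      _ = ∑ y ∈ N, |v y| / 4 := Finset.sum_congr rfl fun y _ => hquarter y
  have h3 : ∑ y ∈ N, |v y| / 4 ≤ ∑ y ∈ N, m / 4 :=
    Finset.sum_le_sum fun y _ => by have := hxm y; linarith
  have h4 : ∑ y ∈ N, m / 4 = N.card * (m / 4) := by rw [sum_const, nsmul_eq_mul]
  by_contra hμ
  rw [not_lt] at hμ
  -- all inequalities are equalities
  have hN4' : (N.card : ℝ) ≤ 4 := by exact_mod_cast hN4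
  have h1 : m ≤ |μ| * m := le_mul_of_one_le_left hmpos.le hμ
  have hcard : N.card = 4 := by
    have : (4 : ℝ) ≤ N.card := by nlinarith
    have : 4 ≤ N.card := by exact_mod_cast this
    omega
  obtain ⟨y₀, hy₀adj, hy₀⟩ := hright hcard
  have hy₀N : y₀ ∈ N := by simp [hN, hy₀adj]
  have hsumeq : ∑ y ∈ N, |v y| / 4 = ∑ y ∈ N, m / 4 := by
    apply le_antisymm h3
    have : ∑ y ∈ N, m / 4 = m := by
      rw [h4, hcard]
      push_cast
      ring
    linarith
  have hterm := (Finset.sum_eq_sum_iff_of_le fun y _ => by have := hxm y; linarith).1 hsumeq y₀ hy₀N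
  have hy₀M : y₀ ∈ M := by
    simp only [hM, Finset.mem_filter, mem_univ, true_and]
    linarith
  have := hx₀max y₀ hy₀M
  rw [hy₀] at this
  simp at this

/-- All eigenvalues of `Q_S` (as produced by the spectral theorem) have modulus `< 1` when
`G ≤ ℤ²`. [folklore] -/
theorem abs_eigenvalues_lt_one (hG : G ≤ zdGraph 2) (i : S) :
    |(isHermitian_rwKernelMatrix G S).eigenvalues i| < 1 :=
  abs_lt_one_of_mulVec_eq S hG
    ((WithLp.ofLp_eq_zero 2).ne.2 ((isHermitian_rwKernelMatrix G S).eigenvectorBasis.orthonormal.ne_zero i))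
    ((isHermitian_rwKernelMatrix G S).mulVec_eigenvectorBasis i)

end RWLoopDet

/-- **Discharge of `Lawler2018_exp_rwLoopMass_eq_det_ratio`** (Lawler 2018, Prop. 5.2 with
Prop. 3.5 and Def. 3): for `G ≤ ℤ²` with all edges inside the finite `V` and `B ⊆ V`, the loop
series of the loops meeting `B` is summable, `det(I − Q_V) ≠ 0`, and
`exp(m[ℒ(V; B)]) · det(I − Q_V) = det(I − Q_{V∖B})`. Proof: `RWLoopDet` above (trace form of the
printed argument + automatic integrability on `ℤ²`).
[cite: Lawler2018, Proposition 5.2 and Proposition 3.5 (with Definition 3)] -/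
theorem Lawler2018_exp_rwLoopMass_eq_det_ratio_holds : Lawler2018_exp_rwLoopMass_eq_det_ratio := by
  intro G V B hG hV _hB
  have hA : ∀ x y : Site 2, G.Adj x y → x ∈ V := fun x y h => (hV x y h).1
  have hbV := RWLoopDet.abs_eigenvalues_lt_one V hG
  have hbVB := RWLoopDet.abs_eigenvalues_lt_one (V \ B) hG
  obtain ⟨hsum, htsum⟩ := RWLoopDet.summable_rwLoopTerm_and_tsum_eq hA B hbV hbVB
  have hdV := RWLoopDet.det_one_sub_pos (RWLoopDet.isHermitian_rwKernelMatrix G V) hbV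
  have hdVB := RWLoopDet.det_one_sub_pos (RWLoopDet.isHermitian_rwKernelMatrix G (V \ B)) hbVB
  refine ⟨hsum, hdV.ne', ?_⟩
  rw [rwLoopMass_eq_tsum, htsum, Real.exp_sub, Real.exp_neg, Real.exp_neg, Real.exp_log hdV,
    Real.exp_log hdVB]
  field_simp

end Literature.Probability.LatticeModels

end

/-!
## The Green's function `G_V = (I − Q_V)⁻¹` and the printed forms of Prop. 5.2 / Prop. 3.5
(literature-prover 2026-08-15, second append)

Lawler 2018 §2 p. 6: "In matrix form `G = G_A = Σ_{n=0}^∞ Qⁿ`, from which we get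
`(I − Q) G = I`, that is, `G = (I − Q)⁻¹`." Here: for `G ≤ ℤ²` with all edges inside the finite
`V`, the tree's Green's function `rwGreen G x y = Σ_{ω : x → y} 4^{-|ω|}` (in `ℝ≥0∞`) is finite and
equals `((I − Q_V)⁻¹)_{xy}` (`rwGreen_eq_ofReal_inv_apply`, Neumann series eigenvalue by
eigenvalue). Consequences, the remaining displays of Prop. 5.2: `exp{m[ℒ(V; x)]} = G_V(x, x)`
(`exp_rwLoopMass_singleton_eq_rwGreen`, from the determinant identity with `B = {x}` and Cramer's
rule `((I−Q)⁻¹)_{xx} · det(I−Q) = det(I−Q')`, exactly as in the printed proof of Prop. 3.5), and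
`exp{m[ℒ(V)]} = det G_V = 1/det[I − Q]` (`exp_rwLoopMass_eq_det_rwGreen`).
-/

noncomputable section

namespace Literature.Probability.LatticeModels

namespace RWLoopDet

open Matrix Finset SimpleGraph
open scoped ENNReal Classical

section Spectral

variable {n : Type*} [Fintype n] [DecidableEq n] {Q : Matrix n n ℝ}

/-- Entries of `U · diagonal d · Uᵀ` over `ℝ`. [folklore] -/
theorem conj_diagonal_apply (U : Matrix n n ℝ) (d : n → ℝ) (x y : n) :
    (U * diagonal d * star U) x y = ∑ i, U x i * d i * U y i := by
  rw [mul_apply]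
  simp only [mul_diagonal, Matrix.star_apply, star_trivial]

/-- `(Qᵏ)_{xy} = Σᵢ U_{xi} λᵢᵏ U_{yi}`. [folklore] -/
theorem pow_apply_eq_sum (hQ : Q.IsHermitian) (k : ℕ) (x y : n) :
    (Q ^ k) x y = ∑ i, (hQ.eigenvectorUnitary : Matrix n n ℝ) x i * hQ.eigenvalues i ^ k *
      (hQ.eigenvectorUnitary : Matrix n n ℝ) y i := by
  rw [pow_eq_conj hQ k, conj_diagonal_apply]

/-- `(I − Q) · U (I − Λ)⁻¹ Uᵀ = I` when no eigenvalue is `1`. [folklore] -/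
theorem one_sub_mul_conj_inv (hQ : Q.IsHermitian) (hb : ∀ i, |hQ.eigenvalues i| < 1) :
    (1 - Q) * ((hQ.eigenvectorUnitary : Matrix n n ℝ) *
      diagonal (fun i => (1 - hQ.eigenvalues i)⁻¹) * star (hQ.eigenvectorUnitary : Matrix n n ℝ)) =
      1 := by
  rw [one_sub_eq_conj hQ]
  set U : Matrix n n ℝ := (hQ.eigenvectorUnitary : Matrix n n ℝ)
  have hU : star U * U = 1 := Unitary.star_mul_self_of_mem hQ.eigenvectorUnitary.prop
  have hU' : U * star U = 1 := Unitary.mul_star_self_of_mem hQ.eigenvectorUnitary.prop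
  calc U * diagonal (fun i => 1 - hQ.eigenvalues i) * star U *
        (U * diagonal (fun i => (1 - hQ.eigenvalues i)⁻¹) * star U)
      = U * (diagonal (fun i => 1 - hQ.eigenvalues i) * (star U * U) *
          diagonal (fun i => (1 - hQ.eigenvalues i)⁻¹)) * star U := by
        simp only [Matrix.mul_assoc]
    _ = 1 := by
        rw [hU, Matrix.mul_one, diagonal_mul_diagonal]
        have : (fun i => (1 - hQ.eigenvalues i) * (1 - hQ.eigenvalues i)⁻¹) = fun _ => (1 : ℝ) := by
          funext i
          have := hb i
          rw [abs_lt] at this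
          exact mul_inv_cancel₀ (by linarith)
        rw [this, diagonal_one, Matrix.mul_one, hU']

/-- `(I − Q)⁻¹ = U (I − Λ)⁻¹ Uᵀ`. [folklore] -/
theorem inv_one_sub_eq (hQ : Q.IsHermitian) (hb : ∀ i, |hQ.eigenvalues i| < 1) :
    (1 - Q)⁻¹ = (hQ.eigenvectorUnitary : Matrix n n ℝ) *
      diagonal (fun i => (1 - hQ.eigenvalues i)⁻¹) * star (hQ.eigenvectorUnitary : Matrix n n ℝ) :=
  inv_eq_right_inv (one_sub_mul_conj_inv hQ hb)

/-- **Neumann series** `Σₖ (Qᵏ)_{xy} = ((I − Q)⁻¹)_{xy}` for a real symmetric `Q` with spectrum in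
`(-1, 1)` (geometric series eigenvalue by eigenvalue). [folklore] -/
theorem hasSum_pow_apply (hQ : Q.IsHermitian) (hb : ∀ i, |hQ.eigenvalues i| < 1) (x y : n) :
    HasSum (fun k => (Q ^ k) x y) ((1 - Q)⁻¹ x y) := by
  rw [inv_one_sub_eq hQ hb, conj_diagonal_apply]
  simp_rw [pow_apply_eq_sum hQ]
  refine hasSum_sum fun i _ => ?_
  exact ((hasSum_geometric_of_abs_lt_one (hb i)).mul_left
    ((hQ.eigenvectorUnitary : Matrix n n ℝ) x i)).mul_right _

/-- **Cramer / cofactor**: the diagonal entry of the adjugate is the principal minor,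
`adj(M)_{xx} = det M|_{i,j ≠ x}` (expansion along the row `x`, as in the proof of Lawler 2018
Prop. 3.5). [folklore] -/
theorem adjugate_apply_self_eq_det_submatrix {R : Type*} [CommRing R] (M : Matrix n n R) (x : n) :
    M.adjugate x x = (M.submatrix (Subtype.val : {a // a ≠ x} → n) Subtype.val).det := by
  rw [adjugate_apply]
  set M' := M.updateRow x (Pi.single x 1) with hM'
  have hblock := twoBlockTriangular_det M' (fun i => i ≠ x) (by
    intro i hi j hj
    rw [not_not] at hi
    subst hi
    rw [hM', updateRow_self, Pi.single_eq_of_ne hj])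
  rw [hblock]
  have h1 : toSquareBlockProp M' (fun i => i ≠ x) =
      M.submatrix (Subtype.val : {a // a ≠ x} → n) Subtype.val := by
    ext a b
    rw [toSquareBlockProp_def, of_apply, hM', updateRow_ne a.2, submatrix_apply]
  haveI : Unique {a // ¬a ≠ x} :=
    ⟨⟨⟨x, fun h => h rfl⟩⟩, fun a => Subtype.ext (not_not.1 a.2)⟩
  have h2 : (toSquareBlockProp M' (fun i => ¬i ≠ x)).det = 1 := by
    rw [det_unique, toSquareBlockProp_def, of_apply]
    have hx : ((default : {a // ¬a ≠ x}) : n) = x := not_not.1 (default : {a // ¬a ≠ x}).2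
    rw [hx, hM', updateRow_self, Pi.single_eq_same]
  rw [h1, h2, mul_one]

end Spectral

variable (G : SimpleGraph (Site 2)) (S : Finset (Site 2))

/-- The series over the walks from `u` to `v` (`u, v ∈ S`) staying inside `S`, organised by
length (generalises `tsum_loops_at`). [folklore] -/
theorem tsum_walks_between (u v : S) (g : ℕ → ℝ≥0∞) :
    ∑' p : G.Walk u v, (if (∀ w ∈ p.support, w ∈ S) then g p.length else 0) =
      ∑' k, ((finInduce G S).finsetWalkLength k u v).card * g k := by
  rw [tsum_walk_eq_tsum_fin G S u v]
  · have : ∀ q : (finInduce G S).Walk u v,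
        (if (∀ w ∈ (ofFin q).support, w ∈ S) then g (ofFin q).length else 0) =
        ∑' k, (if k = q.length then g k else 0) := by
      intro q
      rw [tsum_ite_eq, length_ofFin, if_pos]
      intro w hw
      exact mem_of_mem_support_ofFin hw
    simp_rw [this]
    rw [ENNReal.tsum_comm]
    simp_rw [tsum_ite_length]
  · intro p hp
    by_contra h
    exact hp (if_neg h)

variable {G}
variable {A : Finset (Site 2)}

/-- **`G_A = Σₙ Qⁿ = (I − Q)⁻¹`** (Lawler 2018, §2 p. 6), entrywise, for the tree's `rwGreen`
(valued in `ℝ≥0∞`): if all edges of `G` lie in `A` and the spectrum of `Q_A` lies in `(-1,1)`,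
then `rwGreen G x y = ((I − Q_A)⁻¹)_{xy}` for `x, y ∈ A`.
[cite: Lawler2018, §2 (p. 6, G = (I − Q)⁻¹)] -/
theorem rwGreen_eq_ofReal_inv_apply_of_abs_lt (hA : ∀ x y : Site 2, G.Adj x y → x ∈ A)
    (hb : ∀ i, |(isHermitian_rwKernelMatrix G A).eigenvalues i| < 1) (x y : A) :
    rwGreen G x y = ENNReal.ofReal ((1 - rwKernelMatrix G A)⁻¹ x y) := by
  have hK := isHermitian_rwKernelMatrix G A
  unfold rwGreen
  have h1 : ∀ ω : G.Walk x y, ((1 : ℝ≥0∞) / 4) ^ ω.length =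
      if (∀ w ∈ ω.support, w ∈ A) then ((1 : ℝ≥0∞) / 4) ^ ω.length else 0 := fun ω =>
    (if_pos (support_subset_of_start_mem hA ω x.2)).symm
  rw [tsum_congr h1, tsum_walks_between G A x y (fun k => ((1 : ℝ≥0∞) / 4) ^ k)]
  have h2 : ∀ k, (((finInduce G A).finsetWalkLength k x y).card : ℝ≥0∞) * ((1 : ℝ≥0∞) / 4) ^ k =
      ENNReal.ofReal ((rwKernelMatrix G A ^ k) x y) := by
    intro k
    rw [rwKernelMatrix_pow_apply, ENNReal.ofReal_mul (by positivity), ENNReal.ofReal_pow (by norm_num),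
      ENNReal.ofReal_div_of_pos (by norm_num), ENNReal.ofReal_one, ENNReal.ofReal_ofNat,
      ENNReal.ofReal_natCast, mul_comm]
  simp_rw [h2]
  rw [← ENNReal.ofReal_tsum_of_nonneg (fun k => rwKernelMatrix_pow_apply_nonneg G A k x y)
    (hasSum_pow_apply hK hb x y).summable, (hasSum_pow_apply hK hb x y).tsum_eq]

/-- Entries of `(I − Q_A)⁻¹ = Σₙ Q_Aⁿ` are nonnegative. [folklore] -/
theorem inv_apply_nonneg (hb : ∀ i, |(isHermitian_rwKernelMatrix G A).eigenvalues i| < 1) (x y : A) :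
    0 ≤ (1 - rwKernelMatrix G A)⁻¹ x y :=
  (hasSum_pow_apply (isHermitian_rwKernelMatrix G A) hb x y).nonneg fun k =>
    rwKernelMatrix_pow_apply_nonneg G A k x y

/-- **Cramer's rule step of Lawler 2018, proof of Prop. 3.5**:
`((I − Q_A)⁻¹)_{xx} · det(I − Q_A) = det(I − Q_{A ∖ {x}})`. [cite: Lawler2018, Proposition 3.5 (proof, Cramer's rule)] -/
theorem inv_apply_self_mul_det (hb : ∀ i, |(isHermitian_rwKernelMatrix G A).eigenvalues i| < 1) (x : A) :
    (1 - rwKernelMatrix G A)⁻¹ x x * (1 - rwKernelMatrix G A).det =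
      ((1 : Matrix ↥(A \ {(x : Site 2)}) ↥(A \ {(x : Site 2)}) ℝ) -
        rwKernelMatrix G (A \ {(x : Site 2)})).det := by
  have hdet : (1 - rwKernelMatrix G A).det ≠ 0 := (det_one_sub_pos _ hb).ne'
  rw [Matrix.inv_def, Matrix.smul_apply, smul_eq_mul, Ring.inverse_eq_inv, mul_comm ((1 - rwKernelMatrix G A).det)⁻¹,
    mul_assoc, inv_mul_cancel₀ hdet, mul_one, adjugate_apply_self_eq_det_submatrix]
  -- reindex the principal minor by `↥(A \ {x})`
  let e : {a : A // a ≠ x} ≃ ↥(A \ {(x : Site 2)}) :=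
    { toFun := fun a => ⟨(a.1 : Site 2), Finset.mem_sdiff.2 ⟨a.1.2, fun h => a.2
        (Subtype.ext (Finset.mem_singleton.1 h))⟩⟩
      invFun := fun b => ⟨⟨(b : Site 2), (Finset.mem_sdiff.1 b.2).1⟩, fun h =>
        (Finset.mem_sdiff.1 b.2).2 (Finset.mem_singleton.2 (congrArg Subtype.val h))⟩
      left_inv := fun a => Subtype.ext (Subtype.ext rfl)
      right_inv := fun b => Subtype.ext rfl }
  rw [← det_submatrix_equiv_self e.symm]
  congr 1
  ext b b'
  have hval : ∀ c : ↥(A \ {(x : Site 2)}), (((e.symm c : {a : A // a ≠ x}) : A) : Site 2) = c :=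
    fun c => rfl
  have hiff : ((e.symm b : {a : A // a ≠ x}) : A) = ((e.symm b' : {a : A // a ≠ x}) : A) ↔ b = b' := by
    constructor
    · intro h
      exact Subtype.ext (congrArg (fun a : A => (a : Site 2)) h)
    · rintro rfl
      rfl
  simp only [Matrix.submatrix_apply, Matrix.sub_apply, Matrix.one_apply, rwKernelMatrix_apply, hval,
    hiff]

end RWLoopDet

open RWLoopDet in
/-- **`G_V = (I − Q_V)⁻¹` on `ℤ²`** (Lawler 2018, §2 p. 6: "`G = G_A = Σ Qⁿ`, … `G = (I − Q)⁻¹`"): for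
`G ≤ ℤ²` with all edges inside the finite `V`, and `x, y ∈ V`, the Green's function of the walk
killed off `G` is `rwGreen G x y = ((I − Q_V)⁻¹)_{xy}` (in particular finite).
[cite: Lawler2018, §2 (p. 6, G = (I − Q)⁻¹)] -/
theorem rwGreen_eq_ofReal_inv_apply {G : SimpleGraph (Site 2)} {V : Finset (Site 2)}
    (hG : G ≤ zdGraph 2) (hV : ∀ x y : Site 2, G.Adj x y → x ∈ V) (x y : V) :
    rwGreen G x y = ENNReal.ofReal ((1 - rwKernelMatrix G V)⁻¹ x y) :=
  rwGreen_eq_ofReal_inv_apply_of_abs_lt hV (abs_eigenvalues_lt_one V hG) x y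

open RWLoopDet in
/-- The killed Green's function on a finite piece of `ℤ²` is finite (transience of the killed
walk; the rider "finiteness of `rwGreen` on finite killed domains" of `RandomWalkLoopMeasure`).
[cite: Lawler2018, §2 (integrable weights, G finite)] -/
theorem rwGreen_ne_top {G : SimpleGraph (Site 2)} {V : Finset (Site 2)}
    (hG : G ≤ zdGraph 2) (hV : ∀ x y : Site 2, G.Adj x y → x ∈ V) (x y : V) :
    rwGreen G x y ≠ ⊤ := by
  rw [rwGreen_eq_ofReal_inv_apply hG hV x y]
  exact ENNReal.ofReal_ne_top

open RWLoopDet in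
/-- **Lawler 2018, Prop. 5.2, first display: `exp{m[ℒ(A; x)]} = G_A(x, x)`**, for `G ≤ ℤ²` with all
edges inside the finite `V` and `x ∈ V` (via the determinant identity with `B = {x}` and Cramer's
rule, as in the printed proof of Prop. 3.5). [cite: Lawler2018, Proposition 5.2 (first display)] -/
theorem exp_rwLoopMass_singleton_eq_rwGreen {G : SimpleGraph (Site 2)} {V : Finset (Site 2)}
    (hG : G ≤ zdGraph 2) (hV : ∀ x y : Site 2, G.Adj x y → x ∈ V) (x : V) :
    Real.exp (rwLoopMass G {(x : Site 2)}) = (rwGreen G x x).toReal := by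
  have hbV := abs_eigenvalues_lt_one V hG
  have hbVB := abs_eigenvalues_lt_one (V \ {(x : Site 2)}) hG
  obtain ⟨-, htsum⟩ := summable_rwLoopTerm_and_tsum_eq hV {(x : Site 2)} hbV hbVB
  have hdV := det_one_sub_pos (isHermitian_rwKernelMatrix G V) hbV
  have hdVB := det_one_sub_pos (isHermitian_rwKernelMatrix G (V \ {(x : Site 2)})) hbVB
  rw [rwGreen_eq_ofReal_inv_apply hG hV x x, ENNReal.toReal_ofReal (inv_apply_nonneg hbV x x),
    ← Finset.coe_singleton, rwLoopMass_eq_tsum, htsum, Real.exp_sub, Real.exp_neg, Real.exp_neg,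
    Real.exp_log hdV, Real.exp_log hdVB]
  have hc := inv_apply_self_mul_det hbV x
  field_simp
  linarith [hc]

open RWLoopDet in
/-- **Lawler 2018, Prop. 5.2 last display with Prop. 3.5: `exp{m[ℒ(A)]} = F(A) = det G_A =
1/det[I − Q]`**, for `G ≤ ℤ²` with all edges inside the finite `V`: the exponential of the loop
measure of all loops equals the determinant of the Green's matrix `[G_V(x,y)]_{x,y ∈ V}` and
`1/det(I − Q_V)`. [cite: Lawler2018, Proposition 5.2 and Proposition 3.5] -/
theorem exp_rwLoopMass_eq_det_rwGreen {G : SimpleGraph (Site 2)} {V : Finset (Site 2)}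
    (hG : G ≤ zdGraph 2) (hV : ∀ x y : Site 2, G.Adj x y → x ∈ V) :
    Real.exp (rwLoopMass G ↑V) = (Matrix.of fun x y : V => (rwGreen G x y).toReal).det ∧
      Real.exp (rwLoopMass G ↑V) = 1 / ((1 : Matrix V V ℝ) - rwKernelMatrix G V).det := by
  have hbV := abs_eigenvalues_lt_one V hG
  have hbVB := abs_eigenvalues_lt_one (V \ V) hG
  obtain ⟨-, htsum⟩ := summable_rwLoopTerm_and_tsum_eq hV V hbV hbVB
  have hdV := det_one_sub_pos (isHermitian_rwKernelMatrix G V) hbV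
  haveI : IsEmpty ↥(V \ V) := ⟨fun z => by simpa using z.2⟩
  have hempty : ((1 : Matrix ↥(V \ V) ↥(V \ V) ℝ) - rwKernelMatrix G (V \ V)).det = 1 :=
    Matrix.det_isEmpty
  have hexp : Real.exp (rwLoopMass G ↑V) = 1 / ((1 : Matrix V V ℝ) - rwKernelMatrix G V).det := by
    rw [rwLoopMass_eq_tsum, htsum, hempty, Real.log_one, neg_zero, sub_zero,
      Real.exp_neg, Real.exp_log hdV, one_div]
  refine ⟨?_, hexp⟩
  have hmat : (Matrix.of fun x y : V => (rwGreen G x y).toReal) = (1 - rwKernelMatrix G V)⁻¹ := by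
    ext x y
    rw [Matrix.of_apply, rwGreen_eq_ofReal_inv_apply hG hV x y,
      ENNReal.toReal_ofReal (inv_apply_nonneg hbV x y)]
  rw [hexp, hmat, Matrix.det_nonsing_inv, Ring.inverse_eq_inv, one_div]

end Literature.Probability.LatticeModels

end

/-!
## Prop. 5.2 as printed — the three displays, `F_B(A)` in the product form of Def. 3
(literature-prover 2026-08-15, third append; the ledger's name `Lawler2018_prop52`)

Lawler 2018, **Prop. 5.2** (p. 17): *"Suppose that `q` is an integrable weight on `A`.
(•) If `x ∈ A`, `exp{m[ℒ(A; x)]} = G_A(x, x)`. (•) If `B ⊂ A`, then `F_B(A) = exp{m[ℒ(A; B)]}`.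
(•) In particular, `exp{m[ℒ(A)]} = F(A) = det G_A = 1/det[I − Q]`."* Here (Prop. 3.3 / **Def. 3**,
p. 8) `F_B(A) = ∏_{j=1}^n G_{A_j}(x_j, x_j)`, `A_j = A ∖ {x₁, …, x_{j−1}}`, for `B = {x₁, …, xₙ}`,
independent of the enumeration (Prop. 3.3, left as Exercise 3 there and re-obtained from Prop. 5.2:
"we give another expression for `F_B(A)` … that is clearly independent of the ordering").

The fact was filed on the ledger as `Lawler2018_prop52`; the file was afterwards organised around
the determinant-ratio combination `Lawler2018_exp_rwLoopMass_eq_det_ratio` (Prop. 5.2 ∘ Prop. 3.5,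
the form route SAWDeterminantalDiagonal cites), discharged above. This append records the
proposition under its ledger name in the printed three-bullet form — the second bullet in the
PRODUCT form of Def. 3, which is the form Prop. 3.1 and the loop-erased-walk identity
`tsum_loopErase_eq_exp_rwLoopMass` (`LoopErasedWalkIdentity.lean`) consume — and proves it from the
machinery above: bullets 1 and 3 are `exp_rwLoopMass_singleton_eq_rwGreen` and
`exp_rwLoopMass_eq_det_rwGreen`; bullet 2 is the printed induction of Prop. 3.5
("`F(A) = G_A(x₁, x₁) F(A')`", Cramer) read as a telescoping of the determinant ratios
`exp m[ℒ(V; B)] = det(I − Q_{V∖B})/det(I − Q_V)` along the enumeration, the weight restricted to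
`A ∖ {x₁, …, x_{j−1}}` being the walk on `G` with the edges at those vertices deleted
(`SimpleGraph.deleteIncidenceSet`; the kernel matrix off the deleted vertex is unchanged,
`RWLoopDet.rwKernelMatrix_deleteIncidenceSet`). Ordering independence (Prop. 3.3) is the corollary
`rwGreenProd_perm`.
-/

noncomputable section

namespace Literature.Probability.LatticeModels

open scoped ENNReal Classical

/-- Lawler's **`F_{x₁,…,xₙ}(A) = ∏_{j=1}^n G_{A_j}(x_j, x_j)`, `A_j = A ∖ {x₁, …, x_{j−1}}`**
(Prop. 3.3; Def. 3: `F_B(A)` for `B = {x₁, …, xₙ}`), for the Type II simple-random-walk weight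
`1/4` on the edges of `G`, along the enumeration `[x₁, …, xₙ]`: the weight restricted to `A_j` is the
walk on `G` with every edge at `x₁, …, x_{j−1}` deleted, so, recursively (the rule
`F_{B₁ ∪ B₂}(A) = F_{B₁}(A) · F_{B₂}(A ∖ B₁)` after Def. 3), `F_{[]}(G) = 1` and
`F_{x :: l}(G) = G_G(x, x) · F_l(G.deleteIncidenceSet x)`. Valued in `ℝ≥0∞` like `rwGreen`.
[cite: Lawler2018, Definition 3 (with Proposition 3.3)] -/
def rwGreenProd : SimpleGraph (Site 2) → List (Site 2) → ℝ≥0∞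
  | _, [] => 1
  | G, x :: l => rwGreen G x x * rwGreenProd (G.deleteIncidenceSet x) l

/-- `F_{[]} = 1` (empty product). [folklore] -/
@[simp] theorem rwGreenProd_nil (G : SimpleGraph (Site 2)) : rwGreenProd G [] = 1 := rfl

/-- `F_{x :: l}(G) = G_G(x, x) · F_l(G − x)` (Def. 3, unfolded one step). [folklore] -/
@[simp] theorem rwGreenProd_cons (G : SimpleGraph (Site 2)) (x : Site 2) (l : List (Site 2)) :
    rwGreenProd G (x :: l) = rwGreen G x x * rwGreenProd (G.deleteIncidenceSet x) l := rfl

/-- **Lawler 2018, Proposition 5.2** (as printed; the ledger's `Lawler2018_prop52`). *"Suppose that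
`q` is an integrable weight on `A`. • If `x ∈ A`, `exp{m[ℒ(A; x)]} = G_A(x, x)`. • If `B ⊂ A`, then
`F_B(A) = exp{m[ℒ(A; B)]}`. • In particular, `exp{m[ℒ(A)]} = F(A) = det G_A = 1/det[I − Q]`,"*
with `F_B(A) = ∏_{j=1}^n G_{A_j}(x_j, x_j)`, `A_j = A ∖ {x₁,…,x_{j−1}}`, `B = {x₁,…,xₙ}` (Def. 3).
Rendered, as the sibling fact `Lawler2018_exp_rwLoopMass_eq_det_ratio` (same file, the
determinant-ratio combination with Prop. 3.5), for the Type II simple-random-walk weight `1/4` on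
the edges of a subgraph `G ≤ ℤ²` all of whose edges lie in the finite set `V` (= `A`; integrability
is then automatic, see the module docstring), with the tree's `rwLoopMass G W = m[ℒ(V; W)]`,
`rwGreen` (`G_V`, in `ℝ≥0∞`), `rwGreenProd G [x₁,…,xₙ]` (`F_{x₁,…,xₙ}(V)`) and `rwKernelMatrix G V`
(`Q`): (1) `exp m[ℒ(V; x)] = G_V(x, x)` for `x ∈ V`; (2) for every enumeration `x₁, …, xₙ` of a
`B ⊆ V` (a duplicate-free list), `exp m[ℒ(V; B)] = ∏_j G_{V_j}(x_j, x_j)`; (3)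
`exp m[ℒ(V)] = det[G_V(x, y)]_{x,y ∈ V} = 1/det(I − Q_V)`.
[cite: Lawler2018, Proposition 5.2 (with Definition 3 and Proposition 3.5)] -/
def Lawler2018_prop52 : Prop :=
  ∀ (G : SimpleGraph (Site 2)) (V : Finset (Site 2)),
    G ≤ zdGraph 2 → (∀ x y : Site 2, G.Adj x y → x ∈ V ∧ y ∈ V) →
    (∀ x : Site 2, x ∈ V → Real.exp (rwLoopMass G {x}) = (rwGreen G x x).toReal) ∧
    (∀ l : List (Site 2), l.Nodup → (∀ x ∈ l, x ∈ V) →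
        Real.exp (rwLoopMass G {v | v ∈ l}) = (rwGreenProd G l).toReal) ∧
    (Real.exp (rwLoopMass G ↑V) = (Matrix.of fun x y : V => (rwGreen G x y).toReal).det ∧
      Real.exp (rwLoopMass G ↑V) = 1 / ((1 : Matrix V V ℝ) - rwKernelMatrix G V).det)

namespace RWLoopDet

open Matrix Finset SimpleGraph

variable {G : SimpleGraph (Site 2)} {V : Finset (Site 2)}

/-- Deleting the edges at `x` does not change the kernel matrix on a vertex set avoiding `x`
(`Q'` = `Q` restricted to `A' = A ∖ {x}`, as in the proof of Prop. 3.5). [folklore] -/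
theorem rwKernelMatrix_deleteIncidenceSet (x : Site 2) (W : Finset (Site 2)) (hx : x ∉ W) :
    rwKernelMatrix (G.deleteIncidenceSet x) W = rwKernelMatrix G W := by
  ext a b
  have ha : (a : Site 2) ≠ x := fun h => hx (h ▸ a.2)
  have hb : (b : Site 2) ≠ x := fun h => hx (h ▸ b.2)
  simp only [rwKernelMatrix_apply, deleteIncidenceSet_adj, ha, hb, ne_eq, not_false_eq_true,
    and_true]

/-- `exp m[ℒ(V; B)] = det(I − Q_{V∖B}) / det(I − Q_V)` for every finite `B` (the determinant-ratio
form, from the landed trace computation; `B ⊆ V` is not needed since loops only see `B ∩ V`).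
[cite: Lawler2018, Proposition 5.2 and Proposition 3.5] -/
theorem exp_rwLoopMass_eq_det_div (hG : G ≤ zdGraph 2) (hV : ∀ x y : Site 2, G.Adj x y → x ∈ V)
    (B : Finset (Site 2)) :
    Real.exp (rwLoopMass G ↑B) =
      ((1 : Matrix ↥(V \ B) ↥(V \ B) ℝ) - rwKernelMatrix G (V \ B)).det /
        ((1 : Matrix V V ℝ) - rwKernelMatrix G V).det := by
  have hbV := abs_eigenvalues_lt_one V hG
  have hbVB := abs_eigenvalues_lt_one (V \ B) hG
  obtain ⟨-, htsum⟩ := summable_rwLoopTerm_and_tsum_eq hV B hbV hbVB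
  have hdV := det_one_sub_pos (isHermitian_rwKernelMatrix G V) hbV
  have hdVB := det_one_sub_pos (isHermitian_rwKernelMatrix G (V \ B)) hbVB
  rw [rwLoopMass_eq_tsum, htsum, Real.exp_sub, Real.exp_neg, Real.exp_neg, Real.exp_log hdV,
    Real.exp_log hdVB]
  have h1 := hdV.ne'
  have h2 := hdVB.ne'
  field_simp

/-- **Bullet 2 of Prop. 5.2 in product form**, with finiteness: for `G ≤ ℤ²` with all edges
inside `V` and a duplicate-free list `l` of vertices of `V`, `F_l(G) < ∞` and
`exp m[ℒ(V; l)] = F_l(G)`. Induction along the list exactly as in the printed proofs of Prop. 3.5 /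
Prop. 5.2: `exp m[ℒ(V; x :: l)] = [det(I−Q_{V∖x})/det(I−Q_V)] · [det(I−Q_{(V∖x)∖l})/det(I−Q_{V∖x})]`,
the first factor is `exp m[ℒ(V; x)] = G_V(x, x)` (Cramer), the second is the same ratio for the
walk killed at `x`, i.e. on `G.deleteIncidenceSet x` with vertex set `V ∖ {x}`. [cite: Lawler2018, Proposition 5.2 (proof) and Proposition 3.5 (proof)] -/
theorem rwGreenProd_ne_top_and_exp_rwLoopMass_eq (hG : G ≤ zdGraph 2)
    (hV : ∀ x y : Site 2, G.Adj x y → x ∈ V) (l : List (Site 2)) (hl : l.Nodup)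
    (hlV : ∀ x ∈ l, x ∈ V) :
    rwGreenProd G l ≠ ⊤ ∧ Real.exp (rwLoopMass G {v | v ∈ l}) = (rwGreenProd G l).toReal := by
  induction l generalizing G V with
  | nil =>
    refine ⟨by simp, ?_⟩
    have h0 : {v : Site 2 | v ∈ ([] : List (Site 2))} = ∅ := by
      ext v
      simp
    rw [h0, rwLoopMass_empty, Real.exp_zero, rwGreenProd_nil, ENNReal.toReal_one]
  | cons x l ih =>
    obtain ⟨hxl, hl'⟩ := List.nodup_cons.1 hl
    have hxV : x ∈ V := hlV x List.mem_cons_self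
    -- the walk killed at `x`: the graph `G − x` on the vertex set `V ∖ {x}`
    have hG' : G.deleteIncidenceSet x ≤ zdGraph 2 := (G.deleteIncidenceSet_le x).trans hG
    have hV' : ∀ a b : Site 2, (G.deleteIncidenceSet x).Adj a b → a ∈ V \ {x} := by
      intro a b hab
      rw [deleteIncidenceSet_adj] at hab
      exact Finset.mem_sdiff.2 ⟨hV a b hab.1, by simpa using hab.2.1⟩
    have hlV' : ∀ y ∈ l, y ∈ V \ {x} := by
      intro y hy
      refine Finset.mem_sdiff.2 ⟨hlV y (List.mem_cons_of_mem x hy), ?_⟩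
      rw [Finset.mem_singleton]
      rintro rfl
      exact hxl hy
    obtain ⟨htop, hexp⟩ := ih hG' hV' hl' hlV'
    have hfin : rwGreen G x x ≠ ⊤ := rwGreen_ne_top hG hV ⟨x, hxV⟩ ⟨x, hxV⟩
    refine ⟨by rw [rwGreenProd_cons]; exact ENNReal.mul_ne_top hfin htop, ?_⟩
    -- the three determinant ratios
    have hsingle : Real.exp (rwLoopMass G {x}) = (rwGreen G x x).toReal :=
      exp_rwLoopMass_singleton_eq_rwGreen hG hV ⟨x, hxV⟩
    have h1 := exp_rwLoopMass_eq_det_div hG hV ({x} : Finset (Site 2))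
    rw [Finset.coe_singleton] at h1
    have h2 := exp_rwLoopMass_eq_det_div hG hV (x :: l).toFinset
    rw [List.coe_toFinset] at h2
    have h3 := exp_rwLoopMass_eq_det_div hG' hV' l.toFinset
    have hx1 : x ∉ V \ {x} := by simp
    have hx2 : x ∉ (V \ {x}) \ l.toFinset := by simp
    have hW : (V \ {x}) \ l.toFinset = V \ (x :: l).toFinset := by
      rw [List.toFinset_cons, Finset.insert_eq, sdiff_sdiff_left, Finset.sup_eq_union]
    rw [List.coe_toFinset, rwKernelMatrix_deleteIncidenceSet x _ hx1,
      rwKernelMatrix_deleteIncidenceSet x _ hx2] at h3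
    rw [hW] at h3
    have hne : ((1 : Matrix ↥(V \ {x}) ↥(V \ {x}) ℝ) - rwKernelMatrix G (V \ {x})).det ≠ 0 :=
      (det_one_sub_pos (isHermitian_rwKernelMatrix G (V \ {x})) (abs_eigenvalues_lt_one _ hG)).ne'
    have hne0 : ((1 : Matrix V V ℝ) - rwKernelMatrix G V).det ≠ 0 :=
      (det_one_sub_pos (isHermitian_rwKernelMatrix G V) (abs_eigenvalues_lt_one _ hG)).ne'
    rw [rwGreenProd_cons, ENNReal.toReal_mul, ← hsingle, ← hexp, h1, h3, h2]
    field_simp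

end RWLoopDet

open RWLoopDet in
/-- **Lawler 2018, Prop. 5.2, second bullet, product form (Def. 3):
`exp{m[ℒ(A; B)]} = F_B(A) = ∏_{j=1}^n G_{A_j}(x_j, x_j)`** for every enumeration `x₁, …, xₙ` of
`B ⊆ V` (`G ≤ ℤ²`, all edges inside the finite `V`). [cite: Lawler2018, Proposition 5.2 (second bullet) with Definition 3] -/
theorem exp_rwLoopMass_eq_toReal_rwGreenProd {G : SimpleGraph (Site 2)} {V : Finset (Site 2)}
    (hG : G ≤ zdGraph 2) (hV : ∀ x y : Site 2, G.Adj x y → x ∈ V) {l : List (Site 2)}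
    (hl : l.Nodup) (hlV : ∀ x ∈ l, x ∈ V) :
    Real.exp (rwLoopMass G {v | v ∈ l}) = (rwGreenProd G l).toReal :=
  (rwGreenProd_ne_top_and_exp_rwLoopMass_eq hG hV l hl hlV).2

open RWLoopDet in
/-- `F_{x₁,…,xₙ}(V) < ∞` on `ℤ²` (each Green's function of a killed walk on a finite piece of `ℤ²`
is finite). [cite: Lawler2018, §2 (integrable weights) with Definition 3] -/
theorem rwGreenProd_ne_top {G : SimpleGraph (Site 2)} {V : Finset (Site 2)}
    (hG : G ≤ zdGraph 2) (hV : ∀ x y : Site 2, G.Adj x y → x ∈ V) {l : List (Site 2)}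
    (hl : l.Nodup) (hlV : ∀ x ∈ l, x ∈ V) : rwGreenProd G l ≠ ⊤ :=
  (rwGreenProd_ne_top_and_exp_rwLoopMass_eq hG hV l hl hlV).1

open RWLoopDet in
/-- **Lawler 2018, Prop. 3.3 (ordering independence of `F_{x₁,…,xₙ}(A)`)**, obtained as in §5.1
from Prop. 5.2 ("another expression for `F_B(A)` … clearly independent of the ordering"): two
enumerations of the same `B ⊆ V` give the same product. [cite: Lawler2018, Proposition 3.3 (via Proposition 5.2)] -/
theorem rwGreenProd_perm {G : SimpleGraph (Site 2)} {V : Finset (Site 2)}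
    (hG : G ≤ zdGraph 2) (hV : ∀ x y : Site 2, G.Adj x y → x ∈ V) {l₁ l₂ : List (Site 2)}
    (hp : l₁.Perm l₂) (hl : l₁.Nodup) (hlV : ∀ x ∈ l₁, x ∈ V) :
    rwGreenProd G l₁ = rwGreenProd G l₂ := by
  have hl₂ : l₂.Nodup := hp.nodup_iff.1 hl
  have hlV₂ : ∀ x ∈ l₂, x ∈ V := fun x hx => hlV x (hp.mem_iff.2 hx)
  obtain ⟨ht₁, he₁⟩ := rwGreenProd_ne_top_and_exp_rwLoopMass_eq hG hV l₁ hl hlV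
  obtain ⟨ht₂, he₂⟩ := rwGreenProd_ne_top_and_exp_rwLoopMass_eq hG hV l₂ hl₂ hlV₂
  have hset : {v : Site 2 | v ∈ l₁} = {v : Site 2 | v ∈ l₂} := Set.ext fun _ => hp.mem_iff
  rw [hset, he₂] at he₁
  exact (ENNReal.toReal_eq_toReal_iff' ht₁ ht₂).1 he₁.symm

open RWLoopDet in
/-- **Discharge of `Lawler2018_prop52`** (Lawler 2018, Prop. 5.2, the three bullets as printed):
bullet 1 is `exp_rwLoopMass_singleton_eq_rwGreen`, bullet 2 (product form of Def. 3) is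
`exp_rwLoopMass_eq_toReal_rwGreenProd`, bullet 3 is `exp_rwLoopMass_eq_det_rwGreen`.
[cite: Lawler2018, Proposition 5.2 (with Definition 3 and Proposition 3.5)] -/
theorem Lawler2018_prop52_holds : Lawler2018_prop52 := by
  intro G V hG hV
  have hV' : ∀ x y : Site 2, G.Adj x y → x ∈ V := fun x y h => (hV x y h).1
  refine ⟨fun x hx => ?_, fun l hl hlV => exp_rwLoopMass_eq_toReal_rwGreenProd hG hV' hl hlV,
    exp_rwLoopMass_eq_det_rwGreen hG hV'⟩
  exact exp_rwLoopMass_singleton_eq_rwGreen hG hV' ⟨x, hx⟩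

end Literature.Probability.LatticeModels

end
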